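import Summits.Schanuel.Schanuel.Theorems.RootDecomp1KDarkLogSq02

/-!
# RootDecomp1KDarkLogSq — lens 6, generation 19 «DARK LOG-SQUARE KERNEL ⇒ THE POSITIVE-ORDER LAYER F₊ OF 33364 IS CLOSED AT n = 2» (K-R27 (F₊) lane; input NW96 Thm 1 BY NAME) — continuation (RootDecomp1KDarkLogSq03): §1 tail + §2 `logPowMeasure_of_dark` (the TREE class `LogPowMeasure ![t]`, k = 2) + §3 THE CELL `sb_two_of_logHyperRatio`

(lens-6 g19 `DarkLogSq.lean` [HOME/decomp-schanuel-lens-6/g19/ sha256 81ff816b…, 1170 l; NODE L1934 / REQUEST L1935; critic VERDICT L1938 (K-R27 (F₊) cell credit, port GO)]; port by census-1 gen 17 as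
`RootDecomp1KDarkLogSq01`–`06` — see the PORT NOTE of part 01; `--supports stmt-Schanuel-33364`; rung 0.)
-/

noncomputable section

open Complex IntermediateField Filter Polynomial
open Literature.NumberTheory.Transcendental (NesterenkoWaldschmidt1996_thm_1)
open Summit.Schanuel.Schanuel.Theorems.RootDecomp1KHyper
open Summit.Schanuel.Schanuel.Theorems.RootDecomp1KHyper.HyperCell
open Summit.Schanuel.Schanuel.Theorems.RootDecomp1KGeneric (LiouvilleOrder LogSqLiouville sb_two_of_ordRatio
  sb_two_of_lowOrderResidual)
open Summit.Schanuel.Schanuel.Theorems.RootDecomp1KRelLiouvilleCell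

namespace Summit.Schanuel.Schanuel.Theorems.RootDecomp1KDarkLogSq

/-- The kernel at an EXPONENTIAL-ALGEBRAIC point: `t` transcendental with `(t, e^t)` algebraically dependent
(`e^t` algebraic — a logarithm — included: then the relation has constant coefficients). -/
theorem logSqMeasure_of_dep (hNW : NesterenkoWaldschmidt1996_thm_1) {t : ℂ} (ht : Transcendental ℚ t)
    (hdep : ¬ AlgebraicIndependent ℚ ![t, cexp t]) : LogSqMeasure t := by
  obtain ⟨K, G, hGK, hrel⟩ := exists_int_relation ht hdep
  -- `K ≥ 1`: a relation of degree `0` in `e^t` would make `t` algebraic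
  have hK : 0 < K := by
    rcases Nat.eq_zero_or_pos K with h | h
    · exfalso
      subst h
      have h0 : aeval t (G 0) = 0 := by simpa using hrel
      have hG0 : G 0 ≠ 0 := by simpa using hGK
      exact ht (isAlgebraic_of_aeval_int hG0 h0)
    · exact h
  exact logSqMeasure_of_int_relation' hNW (transcendental_ne_zero ht) hK G
    (fun h => ht (isAlgebraic_of_aeval_int hGK h)) hrel

/-- A `LogSqMeasure` point annihilates no non-zero integer polynomial: it is transcendental. -/
theorem transcendental_of_logSqMeasure {t : ℂ} (ht : LogSqMeasure t) : Transcendental ℚ t := by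
  intro halg
  obtain ⟨p, hpirr, -, hpt⟩ :=
    Literature.NumberTheory.Transcendental.NesterenkoWaldschmidt1996.exists_irreducible_int_aeval_eq_zero halg
  obtain ⟨C, hC, hmeas⟩ := ht p.natDegree
  have h := hmeas p hpirr.ne_zero le_rfl
  rw [hpt, norm_zero] at h
  exact absurd h (not_le.mpr (Real.exp_pos _))

/-! ## §2. From the one-variable log-square measure to the TREE class `LogPowMeasure ![t]` (exponent `k = 2`) -/

/-- `LogSqMeasure t → LogPowMeasure ![t]` (bookkeeping as in the TREE lemma `mvPolyMeasure_one_of_polyMeasure`: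
`P ∈ ℤ[X₀] ↦ p`, `len p ≤ (d+1)·mvlen P`, so `1 + log len p ≤ (1 + log (d+1))·(1 + log mvlen P)`). -/
theorem logPowMeasure_one_of_logSqMeasure {t : ℂ} (ht : LogSqMeasure t) :
    LogPowMeasure (![t] : Fin 1 → ℂ) := by
  classical
  intro d
  obtain ⟨C₀, hC₀, hmeas⟩ := ht d
  have hld : 0 ≤ Real.log ((d : ℝ) + 1) := Real.log_nonneg (by linarith only [(Nat.cast_nonneg d : (0 : ℝ) ≤ d)])
  refine ⟨C₀ * (1 + Real.log ((d : ℝ) + 1)) ^ 2, 2, by positivity, fun P hP hdeg => ?_⟩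
  set K : ℕ := (MvPolynomial.finSuccEquiv ℤ 0 P).natDegree with hKdef
  have hKd : K ≤ d := (natDegree_finSuccEquiv_le_totalDegree P).trans hdeg
  set a : ℕ → ℤ := fun k => MvPolynomial.coeff 0 (ycoeff P k) with hadef
  have hyc : ∀ k, ycoeff P k = MvPolynomial.C (a k) := fun k => MvPolynomial.eq_C_of_isEmpty _
  set p : ℤ[X] := Polynomial.map (MvPolynomial.constantCoeff : MvPolynomial (Fin 0) ℤ →+* ℤ)
    (MvPolynomial.finSuccEquiv ℤ 0 P) with hpdef
  have hpcoeff : ∀ k, p.coeff k = a k := fun k => by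
    rw [hpdef, Polynomial.coeff_map, MvPolynomial.constantCoeff_eq]; rfl
  have hpK : p.natDegree ≤ K := by rw [hpdef]; exact Polynomial.natDegree_map_le
  have haK : a K ≠ 0 := by
    intro h0
    have hne : MvPolynomial.finSuccEquiv ℤ 0 P ≠ 0 := (EmbeddingLike.map_ne_zero_iff).mpr hP
    have h1 := Polynomial.leadingCoeff_ne_zero.mpr hne
    rw [Polynomial.leadingCoeff] at h1
    have h2 : ycoeff P K = 0 := by rw [hyc, h0, MvPolynomial.C_0]
    exact h1 h2
  have hp0 : p ≠ 0 := fun h => haK (by rw [← hpcoeff, h, Polynomial.coeff_zero])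
  have heval : Polynomial.aeval t p = MvPolynomial.aeval (![t] : Fin 1 → ℂ) P := by
    have e1 : (![t] : Fin 1 → ℂ) = Fin.cons t (![] : Fin 0 → ℂ) := rfl
    rw [e1, mvaeval_cons_eq_sum P _ t le_rfl,
      Polynomial.aeval_eq_sum_range' (Nat.lt_succ_of_le hpK)]
    refine Finset.sum_congr rfl fun k _ => ?_
    rw [hpcoeff, hyc, MvPolynomial.aeval_C, zsmul_eq_mul, algebraMap_int_eq, eq_intCast]
  have hlenZ : len p ≤ ((d + 1 : ℕ) : ℤ) * mvlen P := by
    calc len p ≤ ∑ k ∈ Finset.range (K + 1), |p.coeff k| := len_le_of_natDegree_le p hpK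
      _ ≤ ∑ _k ∈ Finset.range (K + 1), mvlen P := by
          refine Finset.sum_le_sum fun k _ => ?_
          rw [hpcoeff, hadef]
          exact (abs_coeff_le_mvlen _ _).trans (mvlen_ycoeff_le P k)
      _ = ((K + 1 : ℕ) : ℤ) * mvlen P := by rw [Finset.sum_const, Finset.card_range, nsmul_eq_mul]
      _ ≤ ((d + 1 : ℕ) : ℤ) * mvlen P :=
          mul_le_mul_of_nonneg_right (by exact_mod_cast Nat.succ_le_succ hKd) (mvlen_nonneg P)
  have hlen : ((len p : ℤ) : ℝ) ≤ ((d : ℝ) + 1) * ((mvlen P : ℤ) : ℝ) := by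
    have h : ((len p : ℤ) : ℝ) ≤ ((((d + 1 : ℕ) : ℤ) * mvlen P : ℤ) : ℝ) := by exact_mod_cast hlenZ
    push_cast at h
    linarith
  have hlen1 : (1 : ℝ) ≤ ((len p : ℤ) : ℝ) := by exact_mod_cast one_le_len hp0
  have hmv1 : (1 : ℝ) ≤ ((mvlen P : ℤ) : ℝ) := by exact_mod_cast one_le_mvlen hP
  have hloglen : 0 ≤ Real.log ((len p : ℤ) : ℝ) := Real.log_nonneg hlen1
  have hlogmv : 0 ≤ Real.log ((mvlen P : ℤ) : ℝ) := Real.log_nonneg hmv1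
  -- `1 + log len p ≤ (1 + log (d+1)) (1 + log mvlen P)`
  have hlog : 1 + Real.log ((len p : ℤ) : ℝ) ≤
      (1 + Real.log ((d : ℝ) + 1)) * (1 + Real.log ((mvlen P : ℤ) : ℝ)) := by
    have h1 : Real.log ((len p : ℤ) : ℝ) ≤ Real.log ((d : ℝ) + 1) + Real.log ((mvlen P : ℤ) : ℝ) := by
      rw [← Real.log_mul (by positivity) (by positivity)]
      exact Real.log_le_log (by positivity) hlen
    nlinarith [mul_nonneg hld hlogmv]
  have h1 := hmeas p hp0 (hpK.trans hKd)
  rw [heval] at h1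
  refine le_trans ?_ h1
  rw [Real.exp_le_exp, neg_le_neg_iff]
  have h2 : (1 + Real.log ((len p : ℤ) : ℝ)) ^ 2 ≤
      ((1 + Real.log ((d : ℝ) + 1)) * (1 + Real.log ((mvlen P : ℤ) : ℝ))) ^ 2 :=
    pow_le_pow_left₀ (by positivity) hlog 2
  calc C₀ * (1 + Real.log ((len p : ℤ) : ℝ)) ^ 2
      ≤ C₀ * ((1 + Real.log ((d : ℝ) + 1)) * (1 + Real.log ((mvlen P : ℤ) : ℝ))) ^ 2 :=
        mul_le_mul_of_nonneg_left h2 hC₀.le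
    _ = C₀ * (1 + Real.log ((d : ℝ) + 1)) ^ 2 * (1 + Real.log ((mvlen P : ℤ) : ℝ)) ^ 2 := by ring

/-- **Every exponential-algebraic point carries the TREE class `LogPowMeasure`** (mod NW96 Thm 1).  Before this file the tree had
NO log-power measure at dark points (only `WeakMeasure`, `RootDecomp1KHyper17`, `RootDecomp1KDarkStorey`). -/
theorem logPowMeasure_of_dep (hNW : NesterenkoWaldschmidt1996_thm_1) {t : ℂ} (ht : Transcendental ℚ t)
    (hdep : ¬ AlgebraicIndependent ℚ ![t, cexp t]) : LogPowMeasure (![t] : Fin 1 → ℂ) :=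
  logPowMeasure_one_of_logSqMeasure (logSqMeasure_of_dep hNW ht hdep)

/-- **The dark kernel IN THE TREE CLASS, with the g10 kernel's hypotheses verbatim** (critic frame G19 (1)): an integer
relation `∑ₖ Gₖ(t)·(e^t)^k = 0` (`K ≥ 1`, `G_K(t) ≠ 0`) at `t ≠ 0` gives `LogPowMeasure ![t]` — exponent `k = 2` for every
degree — mod NW96 Thm 1.  No transcendence hypothesis, nothing else registered or posited. -/
theorem logPowMeasure_of_dark (hNW : NesterenkoWaldschmidt1996_thm_1) {t : ℂ} (ht0 : t ≠ 0)
    {K : ℕ} (hK : 0 < K) (G : Fin (K + 1) → ℤ[X]) (hGKt : aeval t (G (Fin.last K)) ≠ 0)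
    (hrel : ∑ k : Fin (K + 1), aeval t (G k) * cexp t ^ (k : ℕ) = 0) : LogPowMeasure (![t] : Fin 1 → ℂ) :=
  logPowMeasure_one_of_logSqMeasure (logSqMeasure_of_int_relation' hNW ht0 hK G hGKt hrel)

/-! ## §3. THE CELL: Schanuel at `(t, ρt)` for every `t ≠ 0` and every log-hyper-Liouville `ρ` -/

/-- **Level 2 down to the log-power floor (kernel, mod NW96 Thm 1).**  Every ℚ-free pair `z` with a real
LOG-HYPER-Liouville ratio has Schanuel's bound.  Case analysis: some coordinate `zᵢ` is transcendental (else the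
ratio is algebraic — it is Liouville); if `(zᵢ, e^{zᵢ})` is algebraically independent the generic cell applies;
else `zᵢ` is an exponential-algebraic point, carries `LogPowMeasure ![zᵢ]` (§2), and the TREE principle
`sb_of_logHyperLiouville_of_logPowMeasure` (`RootDecomp1KRelLiouvilleCell`) closes.  No `WMeasure`,
no `W78LogMeasure`, no `ExplicitRatExpApprox`: NW96 Theorem 1 alone. -/
theorem sb_two_of_logHyperRatio (hNW : NesterenkoWaldschmidt1996_thm_1) {z : Fin 2 → ℂ}
    (hz : LinearIndependent ℚ z) {ρ : ℝ} (hρ : LogHyperLiouville ρ) (h1 : z 1 = (ρ : ℂ) * z 0) :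
    SB 2 z := by
  have h0 : z 0 ≠ 0 := hz.ne_zero 0
  have hρmem : (ρ : ℂ) ∈ adjoin ℚ (SFset z ∪ {I}) := by
    have e : (ρ : ℂ) = z 1 / z 0 := by rw [h1, mul_div_cancel_right₀ _ h0]
    rw [e]; exact ratio_mem_adjoin z
  have hρT : Transcendental ℚ (ρ : ℂ) := transcendental_ofReal_of_liouville hρ.liouville
  -- some coordinate is transcendental
  obtain ⟨i, hi⟩ : ∃ i : Fin 2, Transcendental ℚ (z i) := by
    by_contra hcon
    push Not at hcon
    have ha0 : IsAlgebraic ℚ (z 0) := by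
      have := hcon 0; unfold Transcendental at this; push Not at this; exact this
    have ha1 : IsAlgebraic ℚ (z 1) := by
      have := hcon 1; unfold Transcendental at this; push Not at this; exact this
    apply hρT
    have e : (ρ : ℂ) = z 1 * (z 0)⁻¹ := by rw [h1, mul_inv_cancel_right₀ h0]
    rw [e]
    exact ha1.mul ha0.inv
  by_cases hai : AlgebraicIndependent ℚ ![z i, cexp (z i)]
  · exact sb_two_of_algebraicIndependent_exp i hai
  · have hθ : LogPowMeasure (![z i] : Fin 1 → ℂ) := logPowMeasure_of_dep hNW hi hai
    refine sb_of_logHyperLiouville_of_logPowMeasure (n := 1) hρ hρmem hθ fun j => ?_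
    rw [Fin.fin_one_eq_zero j]
    exact mem_adjoin_SFset_I (Or.inl ⟨i, rfl⟩)

/-- The same cell in the `(t, ρt)` spelling. -/
theorem sb_two_logHyperPair (hNW : NesterenkoWaldschmidt1996_thm_1) {t : ℂ} (ht : t ≠ 0) {ρ : ℝ}
    (hρ : LogHyperLiouville ρ) : SB 2 ![t, (ρ : ℂ) * t] :=
  sb_two_of_logHyperRatio hNW (linearIndependent_pair_of_irrational ht hρ.liouville.irrational) hρ rfl

end Summit.Schanuel.Schanuel.Theorems.RootDecomp1KDarkLogSq

end
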